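import Summits.BirchSwinnertonDyer.Rank1Residual.Supersingular.X7ToricPeriodValuation
import Summits.BirchSwinnertonDyer.Rank1Residual.Supersingular.X7ToricPeriodUnitTamagawa
import Summits.BirchSwinnertonDyer.Rank1Residual.X11b.BDPRouteUpperLinksFieldAll
import Summits.BirchSwinnertonDyer.BirchSwinnertonDyer.Theses.PrintX6
import Literature.NumberTheory.QuadraticFields.KroneckerSplitting
import Literature.NumberTheory.QuadraticFields.HeegnerCondition
import Literature.NumberTheory.EllipticCurves.MatsunoTwistedCurvesLocalProofs
import Literature.NumberTheory.EllipticCurves.ModularityVersionApProofs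
import Literature.NumberTheory.QuadraticForms.PadicHilbertSymbol

/-!
# Sketch — theta-packet idea for `EisensteinHalfFiveLeRest` (stmt-BirchSwinnertonDyer-21116), rev 3

Rev 1 (ideator bsd-idea-19 g4): first-lemma SIGNATURES only — (T) `TamagawaCancellation`, (★)
`TamagawaFreeToricIdentity`, (NV♭) `PacketNonvanishing`, (PAR) `SquareParity`, `SquareParity_of_packet`.

Rev 2 (g5, answers critic V#61 / V#21 price P2, first half) ADDS three kernel-checked theorems and
changes no signature:
* `tamagawaFreeToricIdentity_of_tamagawaCancellation : TamagawaCancellation → TamagawaFreeToricIdentity`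
  — «the genuine first lemma» of the critics of record: the tree's X7 toric-period valuation identity
  `Rank1Residual.Supersingular.exists_shaAn_padicVal_eq_of_toricPeriod_rankZero` (PROVED in the tree
  from its named published inputs) with (T) and `p ∤ #E(ℚ)_tors`, `p ∤ #E^{(d_K)}(ℚ)_tors` substituted
  collapses to `ord_p #Ш_an(E) + ord_p #Ш_an(E^{(d_K)}) = 2 · ord_p P_K(wφ)` (`p ≠ 2` from `5 ≤ p`);
* `shaAn_padicVal_add_eq_two_mul_of_tamagawaCancellationAt` — the same with (T) supplied only at the
  frame in hand (per-cell form);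
* `even_padicValRat_shaAn_of_packetUnit` — the (PAR) rung for one `W` in an explicit frame: a UNIT
  packet member forces `ord_p #Ш_an(W)` even, from (T)-at-the-frame and no main conjecture.

Rev 3 (g5, P2 second half) PROVES (T) at every frame with `(d_K, N) = 1` — the frames the packet
actually uses (all-inert definite frames `(K₀, 1, N)`, `Lines/theta-packet-nv-results.md`): theorem
`tamagawaCancellationAt_of_coprime`, by name from the tree's two one-sided Tamagawa sums
(`X11b.padicValNat_tamagawaProduct_add_twist_le_of_inertSet'`, the `≤`;
`Supersingular.sum_tamagawaExponent_le_padicValNat_tamagawaProduct_add_twist`, the `≥`) once the inert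
set `N⁻.primeFactors`, the splitting of the other bad primes and the vacuity of the très-ramifié clause are
DERIVED from `Semistable`, `GrossWaldspurgerCondition`, the non-split-`N⁺` hypothesis and `(d_K, N) = 1`
via the decomposition law (`Quadratic.ncard_primesOver_eq_two_iff_jacobiSym`, `…_two_eq_two_iff`).
Corollaries without any (T)-hypothesis: `tamagawaCancellationCoprime_holds`,
`shaAn_padicVal_add_eq_two_mul_of_coprime` ((★) at a coprime frame) and
`even_padicValRat_shaAn_of_packetUnit_of_coprime` ((PAR) rung at a coprime frame); and (NV♭-cop)
`PacketNonvanishingCoprime` = (NV♭) with the coprimality clause (the atom in the form the proved (★) consumes;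
`packetNonvanishing_of_coprime`).

Still OPEN on this line: (T) at frames with `(d_K, N) ≠ 1` (ramified multiplicative primes: true —
the twist is additive there, `c ≤ 4 < p` — but the `ℓ = 2`, `d_K = 4m` case is not decided by
`(ord c₄, ord Δ)` and is not in the tree; NOT needed by the packet, which chooses `K`), (T) class-wide (an M-sized port of Tate-curve Tamagawa facts for the
`d_K`-twist at inert / `N⁺` / ramified primes, listed in `Lines/theta-packet.md` §3), (NV♭) (the
line's atom, OPEN in print at a fixed `p`), and the frame-existence inputs which (★) carries as
binders exactly as X7 does (so `SquareParity_of_packet` as typed in rev 1 additionally needs those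
existence facts — recorded, not claimed). No stub of the skeleton of record (`kim_deficit`) is
touched; nothing is registered (`ledger skeleton check` NOT run, W-79); BSD is not proved by any of this.
-/

noncomputable section

open scoped Classical

open WeierstrassCurve NumberField Literature.NumberTheory.EllipticCurves
  Literature.NumberTheory.EllipticCurves.ModularForms
  Literature.NumberTheory.EllipticCurves.Rank1Residual
  Literature.NumberTheory.EllipticCurves.CaiShuTian2014
  Literature.NumberTheory.Automorphic

set_option linter.dupNamespace false

namespace Summit.BirchSwinnertonDyer.BirchSwinnertonDyer.Cruxes.EisensteinHalfFiveLeRest.ThetaPacket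

/-- **(T) Tamagawa cancellation in a non-split-`N⁺` Gross–Waldspurger frame.** For a semistable
`W/ℚ`, an imaginary quadratic `K` satisfying the Gross–Waldspurger condition for `(N⁺, N⁻)` in
which every prime of `N⁺` is a prime of NON-split multiplicative reduction, a prime `p ≥ 5`, and a
globally minimal model `Wd` of the twist `W^{(d_K)}`: the `p`-parts of the two Tamagawa products
add up to exactly `Σ_{ℓ ∣ N⁻} t_W(p; ℓ)` (at an inert `ℓ ∥ N` exactly one of `W`, `Wd` is split with
`c_ℓ = ord_ℓ Δ_min`, the other has `c_ℓ ∈ {1,2}`; at `ℓ ∣ N⁺` both are non-split; at `ℓ ∣ d_K`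
the twist is additive with `c_ℓ ≤ 4 < p`). Provable from the Tate-curve Tamagawa facts. -/
def TamagawaCancellation : Prop :=
  ∀ (W : WeierstrassCurve ℚ) [W.IsElliptic] [W.IsGloballyMinimal] (p : ℕ) [Fact p.Prime]
    (K : Type) [Field K] [NumberField K] (Nplus Nminus : ℕ),
    5 ≤ p → Semistable W → IsImaginaryQuadratic K → GrossWaldspurgerCondition W K Nplus Nminus →
    (∀ ℓ : ℕ, (hℓ : ℓ.Prime) → ℓ ∣ Nplus →
      (haveI : Fact ℓ.Prime := ⟨hℓ⟩; ¬ W.HasSplitMultiplicativeReductionAtPrime ℓ)) →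
    ∀ (Wd : WeierstrassCurve ℚ) [Wd.IsElliptic] [Wd.IsGloballyMinimal] (Cd : VariableChange ℚ),
      Cd • W.quadraticTwist (NumberField.discr K : ℚ) = Wd →
      padicValNat p W.tamagawaProduct + padicValNat p Wd.tamagawaProduct =
        ∑ ℓ ∈ Nminus.primeFactors, tamagawaExponent W p ℓ

/-- **(★) The Tamagawa-free toric identity on the Rest locus** (first lemma of the line): in the
frame of (T), with no `p`-torsion on `W` and `Wd` (automatic on X6: `ρ̄` surjective), the X7
valuation identity `exists_shaAn_padicVal_eq_of_toricPeriod_rankZero` collapses to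
`ord_p #Ш_an(W) + ord_p #Ш_an(Wd) = 2 · ord_p P_K(wφ)`. -/
def TamagawaFreeToricIdentity : Prop :=
  ∀ (W : WeierstrassCurve ℚ) [W.IsElliptic] [W.IsGloballyMinimal] [NeZero (W.conductorNorm ℤ)]
    (p : ℕ) [Fact p.Prime] (K : Type) [Field K] [NumberField K]
    {Nplus Nminus : ℕ} (S : Brandt.XiSetup Nplus Nminus) [Fintype (Brandt.ClassSet S.O)]
    (ψ : K →ₐ[ℚ] S.D) (_hψ : Brandt.IsGrossPoint S.O ψ S.O)
    (φ : Brandt.ClassSet S.O → ℤ) (_hφ0 : φ ≠ 0)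
    (_hφ : Brandt.eigenLattice (Nplus * Nminus) (Brandt.matrix S.O) (fun n => W.LFunction n) = ℤ ∙ φ)
    (Dt : ModularParametrizationData W (W.conductorNorm ℤ))
    (_hCST : thm12_trivialChar)
    (_hGZK : rank_eq_analyticRank_of_analyticRank_le_one) (_hmod : hasEntireLFunction_rat)
    (_hdeg : padicValNat p Dt.deg =
      padicValNat p (S.xi fun n => W.LFunction n) + ∑ ℓ ∈ Nminus.primeFactors, tamagawaExponent W p ℓ)
    (_hK : IsImaginaryQuadratic K) (_hGW : GrossWaldspurgerCondition W K Nplus Nminus)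
    (_h5 : 5 ≤ p) (_hsst : Semistable W)
    (_hNplus : ∀ ℓ : ℕ, (hℓ : ℓ.Prime) → ℓ ∣ Nplus →
      (haveI : Fact ℓ.Prime := ⟨hℓ⟩; ¬ W.HasSplitMultiplicativeReductionAtPrime ℓ))
    (_hc : ¬ (p : ℤ) ∣ Dt.c) (_hμ : ¬ p ∣ Units.torsionOrder K)
    (_hr : W.analyticRank = 0) (q : ℚ) (_hq : shaAn W = (q : ℂ))
    (Wd : WeierstrassCurve ℚ) [Wd.IsElliptic] [Wd.IsGloballyMinimal] (Cd : VariableChange ℚ)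
    (_hWd : Cd • W.quadraticTwist (NumberField.discr K : ℚ) = Wd)
    (_hu : padicValRat p (Cd.u : ℚ) = 0) (_hrd : Wd.analyticRank = 0)
    (_htors : ¬ p ∣ W.torsionOrder) (_htorsd : ¬ p ∣ Wd.torsionOrder),
    ∃ qd : ℚ, shaAn Wd = (qd : ℂ) ∧
      padicValRat p q + padicValRat p qd =
        2 * padicValInt p (Brandt.toricPeriod S.O ψ S.O (fun i => (Brandt.weight S.O i : ℤ) * φ i))

/-- **(NV♭) Packet non-vanishing mod `p`** (Agashe 2010 hypothesis (∗); Prasanna 2010's packet gcd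
`p ∤ δ_S(E)`): some Gross–Waldspurger field `K` of the non-split-`N⁺` frame, with `p ∤ #𝓞_K^×`,
has a twist `W^{(d_K)}` of analytic rank `0` whose analytic Sha is a `p`-adic unit. OPEN at a
fixed `p` (known for all but finitely many `p`: Ono–Skinner 1998); IMC-free. -/
def PacketNonvanishing (W : WeierstrassCurve ℚ) [W.IsElliptic] [W.IsGloballyMinimal] (p : ℕ)
    [Fact p.Prime] : Prop :=
  ∃ (K : Type) (_ : Field K) (_ : NumberField K) (Nplus Nminus : ℕ),
    IsImaginaryQuadratic K ∧ GrossWaldspurgerCondition W K Nplus Nminus ∧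
    (∀ ℓ : ℕ, (hℓ : ℓ.Prime) → ℓ ∣ Nplus →
      (haveI : Fact ℓ.Prime := ⟨hℓ⟩; ¬ W.HasSplitMultiplicativeReductionAtPrime ℓ)) ∧
    ¬ p ∣ Units.torsionOrder K ∧
    ∃ (Wd : WeierstrassCurve ℚ) (_ : Wd.IsElliptic) (_ : Wd.IsGloballyMinimal) (Cd : VariableChange ℚ),
      Cd • W.quadraticTwist (NumberField.discr K : ℚ) = Wd ∧ padicValRat p (Cd.u : ℚ) = 0 ∧
      Wd.analyticRank = 0 ∧ ∃ qd : ℚ, shaAn Wd = (qd : ℂ) ∧ padicValRat p qd = 0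

/-- **(PAR) Square parity of analytic Sha on the Rest locus** — the rung: for `W` in the scope of
`EisensteinHalfFiveLeRest` the `p`-adic valuation of `#Ш_an(W)` is EVEN. A consequence of the crux
(with Kato's upper half and Cassels–Tate), and — by (★) — of (NV♭) alone. -/
def SquareParity : Prop :=
  ∀ (W : WeierstrassCurve ℚ) [W.IsElliptic] [W.IsGloballyMinimal] (p : ℕ) [Fact p.Prime],
    ¬ W.HasCM → 5 ≤ p → ClassX6 W p → W.analyticRank = 0 →
    ¬ Summit.BirchSwinnertonDyer.Rank1Residual.Supersingular.HasErratumPrime W p →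
    ∀ q : ℚ, shaAn W = (q : ℂ) → Even (padicValRat p q)

/-- The parity rung from the packet: (★) + (NV♭) ⇒ (PAR), curve by curve. -/
def SquareParity_of_packet : Prop :=
  TamagawaFreeToricIdentity →
  ∀ (W : WeierstrassCurve ℚ) [W.IsElliptic] [W.IsGloballyMinimal] (p : ℕ) [Fact p.Prime],
    ¬ W.HasCM → 5 ≤ p → ClassX6 W p → W.analyticRank = 0 →
    PacketNonvanishing W p →
    ∀ q : ℚ, shaAn W = (q : ℂ) → Even (padicValRat p q)

/-! ## Rev 2 (g5): the composition (★) ⟸ X7 + (T), kernel-checked -/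

/-- **(★) ⟸ X7 + (T).** The Tamagawa-free toric identity on the Rest locus follows from the tree's
X7 valuation identity `exists_shaAn_padicVal_eq_of_toricPeriod_rankZero` once the Tamagawa
cancellation (T) and the absence of `p`-torsion on `W` and `Wd` are substituted: the raw identity
`ord_p q + ord_p qd + ord_p ∏c(E) + ord_p ∏c(Wd) = 2 ord_p P + Σ_{ℓ∣N⁻} t_E(ℓ) + 2 ord_p #E_tors + 2 ord_p #Wd_tors`
loses `ord_p ∏c(E) + ord_p ∏c(Wd)` against `Σ t_E(ℓ)` by (T) and the two torsion terms vanish. -/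
theorem tamagawaFreeToricIdentity_of_tamagawaCancellation (hT : TamagawaCancellation) :
    TamagawaFreeToricIdentity := by
  intro W _ _ _ p _ K _ _ Nplus Nminus S _ ψ hψ φ hφ0 hφ Dt hCST hGZK hmod hdeg hK hGW h5 hsst hNplus
    hc hμ hr q hq Wd _ _ Cd hWd hu hrd htors htorsd
  have hp2 : p ≠ 2 := by omega
  obtain ⟨-, -, qd, hqd, hid⟩ :=
    Summit.BirchSwinnertonDyer.Rank1Residual.Supersingular.exists_shaAn_padicVal_eq_of_toricPeriod_rankZero
      W p K S ψ hψ φ hφ0 hφ Dt hCST hGZK hmod hdeg hK hGW hp2 hc hμ hr q hq Wd Cd hWd hu hrd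
  have hTT : padicValNat p W.tamagawaProduct + padicValNat p Wd.tamagawaProduct =
      ∑ ℓ ∈ Nminus.primeFactors, tamagawaExponent W p ℓ :=
    hT W p K Nplus Nminus h5 hsst hK hGW hNplus Wd Cd hWd
  have ht1 : padicValNat p W.torsionOrder = 0 := padicValNat.eq_zero_of_not_dvd htors
  have ht2 : padicValNat p Wd.torsionOrder = 0 := padicValNat.eq_zero_of_not_dvd htorsd
  have hTZ : (padicValNat p W.tamagawaProduct : ℤ) + (padicValNat p Wd.tamagawaProduct : ℤ) =
      ((∑ ℓ ∈ Nminus.primeFactors, tamagawaExponent W p ℓ : ℕ) : ℤ) := by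
    exact_mod_cast hTT
  refine ⟨qd, hqd, ?_⟩
  rw [ht1, ht2] at hid
  push_cast at hid hTZ ⊢
  linarith

/-- The same composition with (T) supplied only AT the frame in hand (the form a prover uses when (T)
is available for one `(W, K, N⁺, N⁻)` — e.g. a per-cell certificate — rather than class-wide). -/
theorem shaAn_padicVal_add_eq_two_mul_of_tamagawaCancellationAt
    (W : WeierstrassCurve ℚ) [W.IsElliptic] [W.IsGloballyMinimal] [NeZero (W.conductorNorm ℤ)]
    (p : ℕ) [Fact p.Prime] (K : Type) [Field K] [NumberField K]
    {Nplus Nminus : ℕ} (S : Brandt.XiSetup Nplus Nminus) [Fintype (Brandt.ClassSet S.O)]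
    (ψ : K →ₐ[ℚ] S.D) (hψ : Brandt.IsGrossPoint S.O ψ S.O)
    (φ : Brandt.ClassSet S.O → ℤ) (hφ0 : φ ≠ 0)
    (hφ : Brandt.eigenLattice (Nplus * Nminus) (Brandt.matrix S.O) (fun n => W.LFunction n) = ℤ ∙ φ)
    (Dt : ModularParametrizationData W (W.conductorNorm ℤ))
    (hCST : thm12_trivialChar)
    (hGZK : rank_eq_analyticRank_of_analyticRank_le_one) (hmod : hasEntireLFunction_rat)
    (hdeg : padicValNat p Dt.deg =
      padicValNat p (S.xi fun n => W.LFunction n) + ∑ ℓ ∈ Nminus.primeFactors, tamagawaExponent W p ℓ)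
    (hK : IsImaginaryQuadratic K) (hGW : GrossWaldspurgerCondition W K Nplus Nminus)
    (h5 : 5 ≤ p) (hc : ¬ (p : ℤ) ∣ Dt.c) (hμ : ¬ p ∣ Units.torsionOrder K)
    (hr : W.analyticRank = 0) (q : ℚ) (hq : shaAn W = (q : ℂ))
    (Wd : WeierstrassCurve ℚ) [Wd.IsElliptic] [Wd.IsGloballyMinimal] (Cd : VariableChange ℚ)
    (hWd : Cd • W.quadraticTwist (NumberField.discr K : ℚ) = Wd)
    (hu : padicValRat p (Cd.u : ℚ) = 0) (hrd : Wd.analyticRank = 0)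
    (htors : ¬ p ∣ W.torsionOrder) (htorsd : ¬ p ∣ Wd.torsionOrder)
    -- (T) at this frame only
    (hTat : padicValNat p W.tamagawaProduct + padicValNat p Wd.tamagawaProduct =
      ∑ ℓ ∈ Nminus.primeFactors, tamagawaExponent W p ℓ) :
    ∃ qd : ℚ, shaAn Wd = (qd : ℂ) ∧
      padicValRat p q + padicValRat p qd =
        2 * padicValInt p (Brandt.toricPeriod S.O ψ S.O (fun i => (Brandt.weight S.O i : ℤ) * φ i)) := by
  have hp2 : p ≠ 2 := by omega
  obtain ⟨-, -, qd, hqd, hid⟩ :=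
    Summit.BirchSwinnertonDyer.Rank1Residual.Supersingular.exists_shaAn_padicVal_eq_of_toricPeriod_rankZero
      W p K S ψ hψ φ hφ0 hφ Dt hCST hGZK hmod hdeg hK hGW hp2 hc hμ hr q hq Wd Cd hWd hu hrd
  have ht1 : padicValNat p W.torsionOrder = 0 := padicValNat.eq_zero_of_not_dvd htors
  have ht2 : padicValNat p Wd.torsionOrder = 0 := padicValNat.eq_zero_of_not_dvd htorsd
  have hTZ : (padicValNat p W.tamagawaProduct : ℤ) + (padicValNat p Wd.tamagawaProduct : ℤ) =
      ((∑ ℓ ∈ Nminus.primeFactors, tamagawaExponent W p ℓ : ℕ) : ℤ) := by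
    exact_mod_cast hTat
  refine ⟨qd, hqd, ?_⟩
  rw [ht1, ht2] at hid
  push_cast at hid hTZ ⊢
  linarith

/-- **Square parity from the packet, honest form.** In the frame of (★) (all existence data as binders,
exactly as X7 carries them), if the packet member `Wd` has `p`-adic-unit analytic Sha then
`ord_p #Ш_an(W)` is even — the (PAR) rung for this `W`, from (T)-at-the-frame and no main conjecture. -/
theorem even_padicValRat_shaAn_of_packetUnit
    (W : WeierstrassCurve ℚ) [W.IsElliptic] [W.IsGloballyMinimal] [NeZero (W.conductorNorm ℤ)]
    (p : ℕ) [Fact p.Prime] (K : Type) [Field K] [NumberField K]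
    {Nplus Nminus : ℕ} (S : Brandt.XiSetup Nplus Nminus) [Fintype (Brandt.ClassSet S.O)]
    (ψ : K →ₐ[ℚ] S.D) (hψ : Brandt.IsGrossPoint S.O ψ S.O)
    (φ : Brandt.ClassSet S.O → ℤ) (hφ0 : φ ≠ 0)
    (hφ : Brandt.eigenLattice (Nplus * Nminus) (Brandt.matrix S.O) (fun n => W.LFunction n) = ℤ ∙ φ)
    (Dt : ModularParametrizationData W (W.conductorNorm ℤ))
    (hCST : thm12_trivialChar)
    (hGZK : rank_eq_analyticRank_of_analyticRank_le_one) (hmod : hasEntireLFunction_rat)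
    (hdeg : padicValNat p Dt.deg =
      padicValNat p (S.xi fun n => W.LFunction n) + ∑ ℓ ∈ Nminus.primeFactors, tamagawaExponent W p ℓ)
    (hK : IsImaginaryQuadratic K) (hGW : GrossWaldspurgerCondition W K Nplus Nminus)
    (h5 : 5 ≤ p) (hc : ¬ (p : ℤ) ∣ Dt.c) (hμ : ¬ p ∣ Units.torsionOrder K)
    (hr : W.analyticRank = 0) (q : ℚ) (hq : shaAn W = (q : ℂ))
    (Wd : WeierstrassCurve ℚ) [Wd.IsElliptic] [Wd.IsGloballyMinimal] (Cd : VariableChange ℚ)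
    (hWd : Cd • W.quadraticTwist (NumberField.discr K : ℚ) = Wd)
    (hu : padicValRat p (Cd.u : ℚ) = 0) (hrd : Wd.analyticRank = 0)
    (htors : ¬ p ∣ W.torsionOrder) (htorsd : ¬ p ∣ Wd.torsionOrder)
    (hTat : padicValNat p W.tamagawaProduct + padicValNat p Wd.tamagawaProduct =
      ∑ ℓ ∈ Nminus.primeFactors, tamagawaExponent W p ℓ)
    -- the packet member is a UNIT cell
    (hunit : ∀ qd : ℚ, shaAn Wd = (qd : ℂ) → padicValRat p qd = 0) :
    Even (padicValRat p q) := by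
  obtain ⟨qd, hqd, hid⟩ := shaAn_padicVal_add_eq_two_mul_of_tamagawaCancellationAt W p K S ψ hψ φ hφ0
    hφ Dt hCST hGZK hmod hdeg hK hGW h5 hc hμ hr q hq Wd Cd hWd hu hrd htors htorsd hTat
  have h0 := hunit qd hqd
  refine ⟨padicValInt p (Brandt.toricPeriod S.O ψ S.O (fun i => (Brandt.weight S.O i : ℤ) * φ i)), ?_⟩
  linarith

/-! ## Rev 3 (g5): (T) PROVED at the frames with `(d_K, N) = 1` -/

/-- **(T) at a frame with `(d_K, N) = 1` — PROVED.** `W/ℚ` semistable and globally minimal, `p ≥ 5`,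
`K` imaginary quadratic with `GrossWaldspurgerCondition W K N⁺ N⁻`, every prime of `N⁺` non-split
multiplicative, `d_K` prime to `N`, `Wd = Cd • W^{(d_K)}` globally minimal. Then
`ord_p ∏c(W) + ord_p ∏c(Wd) = Σ_{ℓ ∣ N⁻} t_W(p; ℓ)`. Proof: the primes of `N⁻` are exactly the inert bad
primes (GW (i),(iii) + coprimality; at an odd `ℓ`, `(d_K/ℓ) = −1` by `ncard_primesOver_eq_two_iff_jacobiSym`
and `ℓ ∤ d_K`; at `ℓ = 2`, `d_K ≡ 5 (mod 8)` by Stickelberger and `ncard_primesOver_two_eq_two_iff`), every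
other bad prime splits (`d_K` a square in `ℚ_ℓ`: Hensel, `padic_isSquare_of_jacobiSym_eq_one` /
`padic_isSquare_intCast_of_mod_eight`) and divides `N⁺`, hence is non-split for `W`, so the très-ramifié
clause of the X11b upper sum is vacuous; the two one-sided sums of the tree then meet.
[cite: JetchevSkinnerWan2017, §7.3.1 (eq:tamK) and §7.4.2 (p. 31)]
[cite: SilvermanATAEC1994, Cor. IV.9.2(d) with (b) (PDF p. 340)] -/
theorem tamagawaCancellationAt_of_coprime
    (W : WeierstrassCurve ℚ) [W.IsElliptic] [W.IsGloballyMinimal] (p : ℕ) [Fact p.Prime]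
    (K : Type) [Field K] [NumberField K] (Nplus Nminus : ℕ)
    (h5 : 5 ≤ p) (hsst : Semistable W) (hK : IsImaginaryQuadratic K)
    (hGW : GrossWaldspurgerCondition W K Nplus Nminus)
    (hNplus : ∀ ℓ : ℕ, (hℓ : ℓ.Prime) → ℓ ∣ Nplus →
      (haveI : Fact ℓ.Prime := ⟨hℓ⟩; ¬ W.HasSplitMultiplicativeReductionAtPrime ℓ))
    (hcop : ∀ ℓ : ℕ, ℓ.Prime → ℓ ∣ W.conductorNorm ℤ → ¬ (ℓ : ℤ) ∣ NumberField.discr K)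
    (Wd : WeierstrassCurve ℚ) [Wd.IsElliptic] [Wd.IsGloballyMinimal] (Cd : VariableChange ℚ)
    (hWd : Cd • W.quadraticTwist (NumberField.discr K : ℚ) = Wd) :
    padicValNat p W.tamagawaProduct + padicValNat p Wd.tamagawaProduct =
      ∑ ℓ ∈ Nminus.primeFactors, tamagawaExponent W p ℓ := by
  have h2 : Module.finrank ℚ K = 2 := hK.1
  obtain ⟨hN, hGWloc⟩ := hGW
  have hNpos : 0 < W.conductorNorm ℤ := W.conductorNorm_pos_holds
  have hNm0 : Nminus ≠ 0 := by
    rintro rfl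
    rw [mul_zero] at hN
    omega
  -- a prime of `N` is a multiplicative prime of the semistable `W`
  have hmult_of_dvd : ∀ (ℓ : ℕ) (hℓ : ℓ.Prime), ℓ ∣ W.conductorNorm ℤ →
      (haveI : Fact ℓ.Prime := ⟨hℓ⟩; Mult W ℓ) := by
    intro ℓ hℓ hdvd
    haveI : Fact ℓ.Prime := ⟨hℓ⟩
    have hng : ¬ W.HasGoodReductionAtPrime ℓ :=
      (W.dvd_conductorNorm_iff_not_hasGoodReductionAtPrime ℓ).mp hdvd
    rcases hsst ℓ hℓ with hg | hm
    · exact absurd hg hng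
    · exact hm
  -- a bad prime of `W` divides `N`
  have hdvd_of_not_good : ∀ (ℓ : ℕ) [Fact ℓ.Prime], ¬ W.HasGoodReductionAtPrime ℓ →
      ℓ ∣ W.conductorNorm ℤ := fun ℓ _ hng =>
    (W.dvd_conductorNorm_iff_not_hasGoodReductionAtPrime ℓ).mpr hng
  set T : Finset ℕ := Nminus.primeFactors with hT
  have hmemT : ∀ {ℓ : ℕ}, ℓ.Prime → (ℓ ∈ T ↔ ℓ ∣ Nminus) := fun hℓ =>
    ⟨fun h => Nat.dvd_of_mem_primeFactors h, fun h => Nat.mem_primeFactors.mpr ⟨hℓ, h, hNm0⟩⟩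
  -- (1) the primes of `N⁻` are inert multiplicative primes
  have hS : ∀ ℓ ∈ T, ∃ _ : Fact ℓ.Prime, Mult W ℓ ∧
      ((ℓ ≠ 2 ∧ jacobiSym (NumberField.discr K) ℓ = -1) ∨
        (ℓ = 2 ∧ NumberField.discr K % 8 = 5)) := by
    intro ℓ hℓT
    have hℓ : ℓ.Prime := Nat.prime_of_mem_primeFactors hℓT
    have hℓNm : ℓ ∣ Nminus := Nat.dvd_of_mem_primeFactors hℓT
    have hℓN : ℓ ∣ W.conductorNorm ℤ := hN ▸ Dvd.dvd.mul_left hℓNm Nplus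
    haveI hF : Fact ℓ.Prime := ⟨hℓ⟩
    refine ⟨hF, hmult_of_dvd ℓ hℓ hℓN, ?_⟩
    obtain ⟨hsplitK, -, -⟩ := hGWloc ℓ hℓN
    have hnc : ((Ideal.span {(ℓ : ℤ)}).primesOver (𝓞 K)).ncard ≠ 2 := fun h => hsplitK h hℓNm
    have hℓd : ¬ (ℓ : ℤ) ∣ NumberField.discr K := hcop ℓ hℓ hℓN
    by_cases hℓ2 : ℓ = 2
    · subst hℓ2
      refine Or.inr ⟨rfl, ?_⟩
      have hodd : NumberField.discr K % 2 = 1 := Int.two_dvd_ne_zero.mp (by exact_mod_cast hℓd)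
      have h4 := Literature.NumberTheory.QuadraticFields.Quadratic.discr_emod_four (K := K) h2
      have h81 : NumberField.discr K % 8 ≠ 1 := fun h8 =>
        hnc (by
          simpa using
            (Literature.NumberTheory.QuadraticFields.Quadratic.ncard_primesOver_two_eq_two_iff
              (K := K) h2).mpr h8)
      omega
    · refine Or.inl ⟨hℓ2, ?_⟩
      have hgcd : (NumberField.discr K).gcd ℓ = 1 := by
        exact Int.isCoprime_iff_gcd_eq_one.mp
          ((Nat.prime_iff_prime_int.mp hℓ).coprime_iff_not_dvd.mpr hℓd).symm
      rcases jacobiSym.eq_one_or_neg_one hgcd with h1 | hm1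
      · exact absurd
          ((Literature.NumberTheory.QuadraticFields.Quadratic.ncard_primesOver_eq_two_iff_jacobiSym
            (K := K) h2 hℓ hℓ2).mpr h1) hnc
      · exact hm1
  -- (2) every other bad prime splits in `K`
  have hsplit : ∀ (ℓ : ℕ) [Fact ℓ.Prime], ¬ W.HasGoodReductionAtPrime ℓ → ℓ ∉ T →
      IsSquare (algebraMap ℚ ℚ_[ℓ] (NumberField.discr K : ℚ)) := by
    intro ℓ hF hng hℓT
    have hℓ : ℓ.Prime := hF.out
    have hℓN : ℓ ∣ W.conductorNorm ℤ := hdvd_of_not_good ℓ hng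
    have hℓNm : ¬ ℓ ∣ Nminus := fun h => hℓT ((hmemT hℓ).mpr h)
    have hℓd : ¬ (ℓ : ℤ) ∣ NumberField.discr K := hcop ℓ hℓ hℓN
    obtain ⟨-, -, hinertK⟩ := hGWloc ℓ hℓN
    have hnc : ((Ideal.span {(ℓ : ℤ)}).primesOver (𝓞 K)).ncard = 2 := by
      by_contra h
      exact hℓNm (hinertK h hℓd)
    rw [map_intCast]
    by_cases hℓ2 : ℓ = 2
    · subst hℓ2
      have h8 : NumberField.discr K % 8 = 1 :=
        (Literature.NumberTheory.QuadraticFields.Quadratic.ncard_primesOver_two_eq_two_iff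
          (K := K) h2).mp (by simpa using hnc)
      exact Literature.NumberTheory.QuadraticForms.padic_isSquare_intCast_of_mod_eight rfl h8
    · have hJ : jacobiSym (NumberField.discr K) ℓ = 1 :=
        (Literature.NumberTheory.QuadraticFields.Quadratic.ncard_primesOver_eq_two_iff_jacobiSym
          (K := K) h2 hℓ hℓ2).mp hnc
      exact Literature.NumberTheory.EllipticCurves.padic_isSquare_of_jacobiSym_eq_one hℓ2 hJ
  -- (3) the très-ramifié clause is vacuous: a split multiplicative prime of `W` divides `N⁻`
  have hFC : ∀ (ℓ : ℕ) [Fact ℓ.Prime], ℓ ∉ T → W.HasSplitMultiplicativeReductionAtPrime ℓ →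
      ¬ p ∣ padicValInt ℓ W.minimalDiscriminantInt := by
    intro ℓ hF hℓT hsplitW
    exfalso
    have hℓ : ℓ.Prime := hF.out
    have hng : ¬ W.HasGoodReductionAtPrime ℓ := fun hg =>
      WeierstrassCurve.HasGoodReduction.not_hasMultiplicativeReduction (R := ℤ_[ℓ]) hg
        hsplitW.hasMultiplicativeReductionAtPrime
    have hℓN : ℓ ∣ W.conductorNorm ℤ := hdvd_of_not_good ℓ hng
    have hℓNm : ¬ ℓ ∣ Nminus := fun h => hℓT ((hmemT hℓ).mpr h)
    rw [← hN] at hℓN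
    rcases (Nat.Prime.dvd_mul hℓ).mp hℓN with hNp | hNm
    · exact hNplus ℓ hℓ hNp hsplitW
    · exact hℓNm hNm
  -- (4) the two one-sided sums of the tree meet
  have hupper :=
    Summit.BirchSwinnertonDyer.Rank1Residual.X11b.padicValNat_tamagawaProduct_add_twist_le_of_inertSet'
      W p h5 K Cd hWd T hS hsplit hFC
  have hlower :=
    Summit.BirchSwinnertonDyer.Rank1Residual.Supersingular.sum_tamagawaExponent_le_padicValNat_tamagawaProduct_add_twist
      W p K Cd hWd T hS
  have hsum : ∑ ℓ ∈ T, tamagawaExponent W p ℓ =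
      ∑ ℓ ∈ T, padicValNat p (padicValInt ℓ W.minimalDiscriminantInt) :=
    Finset.sum_congr rfl fun ℓ hℓ => by
      haveI : Fact ℓ.Prime := ⟨Nat.prime_of_mem_primeFactors hℓ⟩
      exact Summit.BirchSwinnertonDyer.Rank1Residual.Supersingular.tamagawaExponent_eq_padicValNat_padicValInt
        W p ℓ
  omega

/-- **(T) restricted to the coprime frames**, as a named Prop: (T) with the extra binder `(d_K, N) = 1`. -/
def TamagawaCancellationCoprime : Prop :=
  ∀ (W : WeierstrassCurve ℚ) [W.IsElliptic] [W.IsGloballyMinimal] (p : ℕ) [Fact p.Prime]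
    (K : Type) [Field K] [NumberField K] (Nplus Nminus : ℕ),
    5 ≤ p → Semistable W → IsImaginaryQuadratic K → GrossWaldspurgerCondition W K Nplus Nminus →
    (∀ ℓ : ℕ, (hℓ : ℓ.Prime) → ℓ ∣ Nplus →
      (haveI : Fact ℓ.Prime := ⟨hℓ⟩; ¬ W.HasSplitMultiplicativeReductionAtPrime ℓ)) →
    (∀ ℓ : ℕ, ℓ.Prime → ℓ ∣ W.conductorNorm ℤ → ¬ (ℓ : ℤ) ∣ NumberField.discr K) →
    ∀ (Wd : WeierstrassCurve ℚ) [Wd.IsElliptic] [Wd.IsGloballyMinimal] (Cd : VariableChange ℚ),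
      Cd • W.quadraticTwist (NumberField.discr K : ℚ) = Wd →
      padicValNat p W.tamagawaProduct + padicValNat p Wd.tamagawaProduct =
        ∑ ℓ ∈ Nminus.primeFactors, tamagawaExponent W p ℓ

/-- `TamagawaCancellationCoprime` HOLDS (kernel-checked; no hypothesis). -/
theorem tamagawaCancellationCoprime_holds : TamagawaCancellationCoprime :=
  fun W _ _ p _ K _ _ Nplus Nminus h5 hsst hK hGW hNplus hcop Wd _ _ Cd hWd =>
    tamagawaCancellationAt_of_coprime W p K Nplus Nminus h5 hsst hK hGW hNplus hcop Wd Cd hWd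

/-- (T) class-wide reduces to its ramified-frame residue: it suffices to prove (T) at the frames with
`(d_K, N) ≠ 1`. (Bookkeeping: the coprime frames are settled by `tamagawaCancellationAt_of_coprime`.) -/
theorem tamagawaCancellation_of_ramifiedFrames
    (hram : ∀ (W : WeierstrassCurve ℚ) [W.IsElliptic] [W.IsGloballyMinimal] (p : ℕ) [Fact p.Prime]
      (K : Type) [Field K] [NumberField K] (Nplus Nminus : ℕ),
      5 ≤ p → Semistable W → IsImaginaryQuadratic K → GrossWaldspurgerCondition W K Nplus Nminus →
      (∀ ℓ : ℕ, (hℓ : ℓ.Prime) → ℓ ∣ Nplus →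
        (haveI : Fact ℓ.Prime := ⟨hℓ⟩; ¬ W.HasSplitMultiplicativeReductionAtPrime ℓ)) →
      (∃ ℓ : ℕ, ℓ.Prime ∧ ℓ ∣ W.conductorNorm ℤ ∧ (ℓ : ℤ) ∣ NumberField.discr K) →
      ∀ (Wd : WeierstrassCurve ℚ) [Wd.IsElliptic] [Wd.IsGloballyMinimal] (Cd : VariableChange ℚ),
        Cd • W.quadraticTwist (NumberField.discr K : ℚ) = Wd →
        padicValNat p W.tamagawaProduct + padicValNat p Wd.tamagawaProduct =
          ∑ ℓ ∈ Nminus.primeFactors, tamagawaExponent W p ℓ) :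
    TamagawaCancellation := by
  intro W _ _ p _ K _ _ Nplus Nminus h5 hsst hK hGW hNplus Wd _ _ Cd hWd
  by_cases hcop : ∀ ℓ : ℕ, ℓ.Prime → ℓ ∣ W.conductorNorm ℤ → ¬ (ℓ : ℤ) ∣ NumberField.discr K
  · exact tamagawaCancellationAt_of_coprime W p K Nplus Nminus h5 hsst hK hGW hNplus hcop Wd Cd hWd
  · push Not at hcop
    exact hram W p K Nplus Nminus h5 hsst hK hGW hNplus hcop Wd Cd hWd

/-- **(★) at a coprime frame — no (T)-hypothesis left.** The Tamagawa-free toric identity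
`ord_p #Ш_an(W) + ord_p #Ш_an(Wd) = 2 · ord_p P_K(wφ)` at any frame of (★) with `(d_K, N) = 1`. -/
theorem shaAn_padicVal_add_eq_two_mul_of_coprime
    (W : WeierstrassCurve ℚ) [W.IsElliptic] [W.IsGloballyMinimal] [NeZero (W.conductorNorm ℤ)]
    (p : ℕ) [Fact p.Prime] (K : Type) [Field K] [NumberField K]
    {Nplus Nminus : ℕ} (S : Brandt.XiSetup Nplus Nminus) [Fintype (Brandt.ClassSet S.O)]
    (ψ : K →ₐ[ℚ] S.D) (hψ : Brandt.IsGrossPoint S.O ψ S.O)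
    (φ : Brandt.ClassSet S.O → ℤ) (hφ0 : φ ≠ 0)
    (hφ : Brandt.eigenLattice (Nplus * Nminus) (Brandt.matrix S.O) (fun n => W.LFunction n) = ℤ ∙ φ)
    (Dt : ModularParametrizationData W (W.conductorNorm ℤ))
    (hCST : thm12_trivialChar)
    (hGZK : rank_eq_analyticRank_of_analyticRank_le_one) (hmod : hasEntireLFunction_rat)
    (hdeg : padicValNat p Dt.deg =
      padicValNat p (S.xi fun n => W.LFunction n) + ∑ ℓ ∈ Nminus.primeFactors, tamagawaExponent W p ℓ)
    (hK : IsImaginaryQuadratic K) (hGW : GrossWaldspurgerCondition W K Nplus Nminus)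
    (h5 : 5 ≤ p) (hsst : Semistable W)
    (hNplus : ∀ ℓ : ℕ, (hℓ : ℓ.Prime) → ℓ ∣ Nplus →
      (haveI : Fact ℓ.Prime := ⟨hℓ⟩; ¬ W.HasSplitMultiplicativeReductionAtPrime ℓ))
    (hcop : ∀ ℓ : ℕ, ℓ.Prime → ℓ ∣ W.conductorNorm ℤ → ¬ (ℓ : ℤ) ∣ NumberField.discr K)
    (hc : ¬ (p : ℤ) ∣ Dt.c) (hμ : ¬ p ∣ Units.torsionOrder K)
    (hr : W.analyticRank = 0) (q : ℚ) (hq : shaAn W = (q : ℂ))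
    (Wd : WeierstrassCurve ℚ) [Wd.IsElliptic] [Wd.IsGloballyMinimal] (Cd : VariableChange ℚ)
    (hWd : Cd • W.quadraticTwist (NumberField.discr K : ℚ) = Wd)
    (hu : padicValRat p (Cd.u : ℚ) = 0) (hrd : Wd.analyticRank = 0)
    (htors : ¬ p ∣ W.torsionOrder) (htorsd : ¬ p ∣ Wd.torsionOrder) :
    ∃ qd : ℚ, shaAn Wd = (qd : ℂ) ∧
      padicValRat p q + padicValRat p qd =
        2 * padicValInt p (Brandt.toricPeriod S.O ψ S.O (fun i => (Brandt.weight S.O i : ℤ) * φ i)) :=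
  shaAn_padicVal_add_eq_two_mul_of_tamagawaCancellationAt W p K S ψ hψ φ hφ0 hφ Dt hCST hGZK hmod hdeg
    hK hGW h5 hc hμ hr q hq Wd Cd hWd hu hrd htors htorsd
    (tamagawaCancellationAt_of_coprime W p K Nplus Nminus h5 hsst hK hGW hNplus hcop Wd Cd hWd)

/-- **(PAR) rung at a coprime frame — no (T)-hypothesis left**: a UNIT packet member at a frame with
`(d_K, N) = 1` forces `ord_p #Ш_an(W)` even. -/
theorem even_padicValRat_shaAn_of_packetUnit_of_coprime
    (W : WeierstrassCurve ℚ) [W.IsElliptic] [W.IsGloballyMinimal] [NeZero (W.conductorNorm ℤ)]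
    (p : ℕ) [Fact p.Prime] (K : Type) [Field K] [NumberField K]
    {Nplus Nminus : ℕ} (S : Brandt.XiSetup Nplus Nminus) [Fintype (Brandt.ClassSet S.O)]
    (ψ : K →ₐ[ℚ] S.D) (hψ : Brandt.IsGrossPoint S.O ψ S.O)
    (φ : Brandt.ClassSet S.O → ℤ) (hφ0 : φ ≠ 0)
    (hφ : Brandt.eigenLattice (Nplus * Nminus) (Brandt.matrix S.O) (fun n => W.LFunction n) = ℤ ∙ φ)
    (Dt : ModularParametrizationData W (W.conductorNorm ℤ))
    (hCST : thm12_trivialChar)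
    (hGZK : rank_eq_analyticRank_of_analyticRank_le_one) (hmod : hasEntireLFunction_rat)
    (hdeg : padicValNat p Dt.deg =
      padicValNat p (S.xi fun n => W.LFunction n) + ∑ ℓ ∈ Nminus.primeFactors, tamagawaExponent W p ℓ)
    (hK : IsImaginaryQuadratic K) (hGW : GrossWaldspurgerCondition W K Nplus Nminus)
    (h5 : 5 ≤ p) (hsst : Semistable W)
    (hNplus : ∀ ℓ : ℕ, (hℓ : ℓ.Prime) → ℓ ∣ Nplus →
      (haveI : Fact ℓ.Prime := ⟨hℓ⟩; ¬ W.HasSplitMultiplicativeReductionAtPrime ℓ))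
    (hcop : ∀ ℓ : ℕ, ℓ.Prime → ℓ ∣ W.conductorNorm ℤ → ¬ (ℓ : ℤ) ∣ NumberField.discr K)
    (hc : ¬ (p : ℤ) ∣ Dt.c) (hμ : ¬ p ∣ Units.torsionOrder K)
    (hr : W.analyticRank = 0) (q : ℚ) (hq : shaAn W = (q : ℂ))
    (Wd : WeierstrassCurve ℚ) [Wd.IsElliptic] [Wd.IsGloballyMinimal] (Cd : VariableChange ℚ)
    (hWd : Cd • W.quadraticTwist (NumberField.discr K : ℚ) = Wd)
    (hu : padicValRat p (Cd.u : ℚ) = 0) (hrd : Wd.analyticRank = 0)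
    (htors : ¬ p ∣ W.torsionOrder) (htorsd : ¬ p ∣ Wd.torsionOrder)
    (hunit : ∀ qd : ℚ, shaAn Wd = (qd : ℂ) → padicValRat p qd = 0) :
    Even (padicValRat p q) :=
  even_padicValRat_shaAn_of_packetUnit W p K S ψ hψ φ hφ0 hφ Dt hCST hGZK hmod hdeg hK hGW h5 hc hμ hr q
    hq Wd Cd hWd hu hrd htors htorsd
    (tamagawaCancellationAt_of_coprime W p K Nplus Nminus h5 hsst hK hGW hNplus hcop Wd Cd hWd) hunit

/-- **(NV♭-cop) Packet non-vanishing mod `p` at a COPRIME frame**: (NV♭) with the extra clause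
`(d_K, N) = 1` — the form the PROVED (★) (`shaAn_padicVal_add_eq_two_mul_of_coprime`) consumes; the
all-inert definite frames `(K₀, 1, N)` of the numerics (`Lines/theta-packet-nv-results.md`) are of this kind. -/
def PacketNonvanishingCoprime (W : WeierstrassCurve ℚ) [W.IsElliptic] [W.IsGloballyMinimal] (p : ℕ)
    [Fact p.Prime] : Prop :=
  ∃ (K : Type) (_ : Field K) (_ : NumberField K) (Nplus Nminus : ℕ),
    IsImaginaryQuadratic K ∧ GrossWaldspurgerCondition W K Nplus Nminus ∧
    (∀ ℓ : ℕ, (hℓ : ℓ.Prime) → ℓ ∣ Nplus →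
      (haveI : Fact ℓ.Prime := ⟨hℓ⟩; ¬ W.HasSplitMultiplicativeReductionAtPrime ℓ)) ∧
    (∀ ℓ : ℕ, ℓ.Prime → ℓ ∣ W.conductorNorm ℤ → ¬ (ℓ : ℤ) ∣ NumberField.discr K) ∧
    ¬ p ∣ Units.torsionOrder K ∧
    ∃ (Wd : WeierstrassCurve ℚ) (_ : Wd.IsElliptic) (_ : Wd.IsGloballyMinimal) (Cd : VariableChange ℚ),
      Cd • W.quadraticTwist (NumberField.discr K : ℚ) = Wd ∧ padicValRat p (Cd.u : ℚ) = 0 ∧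
      Wd.analyticRank = 0 ∧ ∃ qd : ℚ, shaAn Wd = (qd : ℂ) ∧ padicValRat p qd = 0

/-- (NV♭-cop) ⇒ (NV♭) (forget the coprimality clause). -/
theorem packetNonvanishing_of_coprime (W : WeierstrassCurve ℚ) [W.IsElliptic] [W.IsGloballyMinimal]
    (p : ℕ) [Fact p.Prime] (h : PacketNonvanishingCoprime W p) : PacketNonvanishing W p := by
  rcases h with ⟨K, iF, iN, Nplus, Nminus, hK, hGW, hNplus, -, hμ, Wd, iE, iM, Cd, hWd, hu, hrd, hqd⟩
  refine ⟨K, iF, iN, Nplus, Nminus, hK, hGW, hNplus, hμ, Wd, iE, iM, Cd, hWd, hu, hrd, hqd⟩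

end Summit.BirchSwinnertonDyer.BirchSwinnertonDyer.Cruxes.EisensteinHalfFiveLeRest.ThetaPacket

end
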